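import Mathlib
import Summits.Ventures.PercRepro2.Defs
import Summits.Ventures.PercRepro2.Harris
import Summits.Ventures.PercRepro2.Graph
import Summits.Ventures.PercRepro2.Induced
import Summits.Ventures.PercRepro2.VdBKahn
import Summits.Ventures.PercRepro2.NestIID

/-!
# The i.i.d. two-cluster rows: (PU), (DI), (ΔMONO), (STEP1), (NA-A) — statements and the easy
implications (blind cell PercRepro2, mine-1 g9; MINE-1.md §25.8, proofs/MINE1-IID-UNION.md)

Two independent Bernoulli(`p`) clusters `C, C'` of a root `s`; `clusterLaw p ends s H = P(C = H)`.

* `bhkSlack T = P(R_T) P(R_T, x, y ∈ C) − P(R_T, x ∈ C) P(R_T, y ∈ C)` — nonnegative by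
  van den Berg–Kahn (`bhkSlack_nonneg`), and equal to half the diagonal `nestIID` (`nestIID_diag`);
* `unionTerm H'` — the per-union-hull term `Σ_{H₁ ∪ H₂ = H'} P(C = H₁) P(C' = H₂) σ_x σ_y`;
* **`PURow`** ((PU), pointwise in the union hull): `unionTerm H' ≥ 0` for every `H'`;
  **`DIRow`** ((DI), every down-set); `diRow_of_puRow`;
* **`DeltaMonoRow`** ((ΔMONO)): the BHK slack is decreasing in the avoided set;
  `bhkSlack_anti_of_deltaMono`, `bhkSlack_union_le_of_deltaMono` ((DI) for the union of two
  principal down-sets);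
* **`Step1IIDRow`** ((STEP1_iid), a one-copy symmetrised four-term inequality);
* **`NAARow`** ((NA-A): cross-copy cluster events are negatively associated given `C ∪ C' = V`).

Census (mine-1 g9; mild and extreme palettes): (PU) `n = 7 m ≤ 14` 0 / 15,583,680 and `n = 6` extreme
0 / 921,600; (STEP1_iid) `n = 7 m ≤ 12` 0 / 13,925,520, extreme 0 / 518,400; (ΔMONO) extreme 0 / 345,600;
(NA-A) `n = 7 m ≤ 14` 0 / 486,990, extreme 0 / 28,800. The same-copy version of (NA-A) is FALSE at
extreme weights (MINE-1.md §25.8 NEG). Statements and easy implications only.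
-/

namespace Summit.Ventures.PercRepro2

section IIDRows

variable {V : Type*} {E : Type*} [Fintype E] [DecidableEq E] [Fintype V] [DecidableEq V]
  {R : Type*} [CommRing R] [LinearOrder R] [IsStrictOrderedRing R]

variable (p : E → R) (ends : E → Sym2 V) (s x y : V)

open scoped Classical in
/-- The cluster law `P(C(s) = H)` on finsets. -/
noncomputable def clusterLaw (H : Finset V) : R := prob p {ω | cluster ends ω s = (↑H : Set V)}

/-- The BHK slack `P(R_T) P(R_T, x,y ∈ C) − P(R_T, x ∈ C) P(R_T, y ∈ C)`. -/
noncomputable def bhkSlack (T : Finset V) : R :=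
  prob p (avoidAll ends s T) * prob p (connAll ends s ({x} ∪ {y}) ∩ avoidAll ends s T) -
    prob p (connAll ends s {x} ∩ avoidAll ends s T) * prob p (connAll ends s {y} ∩ avoidAll ends s T)

/-- The BHK slack is nonnegative (van den Berg–Kahn, `X = Y = T`). -/
theorem bhkSlack_nonneg (hp : IsProbVec p) (T : Finset V) : 0 ≤ bhkSlack p ends s x y T := by
  have h := vdBK p hp ends s {x} {y} T T
  simp only [Finset.inter_self, Finset.union_self] at h
  unfold bhkSlack
  linarith [h]

omit [LinearOrder R] [IsStrictOrderedRing R] in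
/-- The diagonal two-copy sum is twice the BHK slack. -/
theorem nestIID_diag (T : Finset V) : nestIID p ends s x y T T = 2 * bhkSlack p ends s x y T := by
  rw [nestIID_eq]
  unfold bhkSlack
  ring

open scoped Classical in
/-- The per-union-hull term `Σ_{H₁ ∪ H₂ = H'} P(C = H₁) P(C' = H₂) (1[x∈H₁] − 1[x∈H₂])(1[y∈H₁] − 1[y∈H₂])`. -/
noncomputable def unionTerm (H' : Finset V) : R :=
  ∑ H₁ : Finset V, ∑ H₂ : Finset V, if H₁ ∪ H₂ = H' then
    clusterLaw p ends s H₁ * clusterLaw p ends s H₂ *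
      (((if x ∈ H₁ then 1 else 0) - (if x ∈ H₂ then 1 else 0)) *
        ((if y ∈ H₁ then 1 else 0) - (if y ∈ H₂ then 1 else 0))) else 0

/-- **Row (PU)**: every per-union-hull term is nonnegative. -/
def PURow : Prop := ∀ H' : Finset V, 0 ≤ unionTerm p ends s x y H'

/-- **Row (DI)**: nonnegativity on every down-set of union hulls. -/
def DIRow : Prop := ∀ 𝒟 : Finset (Finset V), IsLowerSet (↑𝒟 : Set (Finset V)) →
  0 ≤ ∑ H' ∈ 𝒟, unionTerm p ends s x y H'

/-- (PU) ⟹ (DI). -/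
theorem diRow_of_puRow (h : PURow p ends s x y) : DIRow p ends s x y :=
  fun _ _ => Finset.sum_nonneg fun H' _ => h H'

/-- **Row (ΔMONO)**: the BHK slack is decreasing in the avoided set. -/
def DeltaMonoRow : Prop := ∀ (T : Finset V) (t : V),
  bhkSlack p ends s x y (insert t T) ≤ bhkSlack p ends s x y T

omit [Fintype V] [IsStrictOrderedRing R] in
/-- (ΔMONO) ⟹ the slack is antitone: `T₁ ⊆ T₂ → Δ(T₂) ≤ Δ(T₁)`. -/
theorem bhkSlack_anti_of_deltaMono (h : DeltaMonoRow p ends s x y) {T₁ T₂ : Finset V}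
    (hT : T₁ ⊆ T₂) : bhkSlack p ends s x y T₂ ≤ bhkSlack p ends s x y T₁ := by
  have key : ∀ S : Finset V, bhkSlack p ends s x y (T₁ ∪ S) ≤ bhkSlack p ends s x y T₁ := by
    intro S
    induction S using Finset.induction_on with
    | empty => simp
    | insert a S _ ih =>
      rw [Finset.union_insert]
      exact (h _ a).trans ih
  have := key T₂
  rwa [Finset.union_eq_right.2 hT] at this

/-- (ΔMONO) ⟹ `Δ(T₁ ∪ T₂) ≤ Δ(T₁) + Δ(T₂)` — (DI) for the union of two principal down-sets. -/
theorem bhkSlack_union_le_of_deltaMono (hp : IsProbVec p) (h : DeltaMonoRow p ends s x y)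
    (T₁ T₂ : Finset V) :
    bhkSlack p ends s x y (T₁ ∪ T₂) ≤ bhkSlack p ends s x y T₁ + bhkSlack p ends s x y T₂ :=
  (bhkSlack_anti_of_deltaMono p ends s x y h Finset.subset_union_left).trans
    (le_add_of_nonneg_right (bhkSlack_nonneg p ends s x y hp T₂))

/-- **Row (STEP1_iid)**: for `X ∪ {w} ⊆ Y`,
`P(R_X, w,x,y) P(R_Y) + P(R_X, w) P(R_Y, x,y) ≥ P(R_X, w,x) P(R_Y, y) + P(R_X, w,y) P(R_Y, x)`. -/
def Step1IIDRow : Prop := ∀ (X Y : Finset V) (w : V), X ⊆ Y → w ∈ Y → w ∉ X →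
  prob p (connAll ends s ({w} ∪ ({x} ∪ {y})) ∩ avoidAll ends s X) * prob p (avoidAll ends s Y) +
    prob p (connAll ends s {w} ∩ avoidAll ends s X) *
      prob p (connAll ends s ({x} ∪ {y}) ∩ avoidAll ends s Y) ≥
  prob p (connAll ends s ({w} ∪ {x}) ∩ avoidAll ends s X) *
      prob p (connAll ends s {y} ∩ avoidAll ends s Y) +
    prob p (connAll ends s ({w} ∪ {y}) ∩ avoidAll ends s X) *
      prob p (connAll ends s {x} ∩ avoidAll ends s Y)

open scoped Classical in
/-- The covering sum `Σ_{H₁ ∪ H₂ = V} P(C = H₁) P(C' = H₂) f(H₁, H₂)`. -/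
noncomputable def coverSum (f : Finset V → Finset V → R) : R :=
  ∑ H₁ : Finset V, ∑ H₂ : Finset V, if H₁ ∪ H₂ = Finset.univ then
    clusterLaw p ends s H₁ * clusterLaw p ends s H₂ * f H₁ H₂ else 0

open scoped Classical in
/-- **Row (NA-A)**: given `C ∪ C' = V`, `{x ∈ C}` and `{y ∈ C'}` are negatively associated:
`P(A) P(A, x ∈ C, y ∈ C') ≤ P(A, x ∈ C) P(A, y ∈ C')`. -/
def NAARow : Prop :=
  coverSum p ends s (fun _ _ => 1) *
      coverSum p ends s (fun H₁ H₂ => if x ∈ H₁ ∧ y ∈ H₂ then 1 else 0) ≤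
    coverSum p ends s (fun H₁ _ => if x ∈ H₁ then 1 else 0) *
      coverSum p ends s (fun _ H₂ => if y ∈ H₂ then 1 else 0)

end IIDRows

end Summit.Ventures.PercRepro2
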